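import Literature.Probability.RandomPlanarGeometry.SLETraceContinuity
import Literature.Probability.RandomPlanarGeometry.RohdeSchrammCor35Proofs
import HarnessLib

/-!
# Chordal SLE_κ is generated by a curve, for every Brownian motion (κ ≠ 8)

Topic `Probability/RandomPlanarGeometry`; proved theorems only (no definition, no named fact).
Rohde–Schramm (2005), Thm. 5.1 (`κ ≠ 8`) in the form needed on a **general** probability space:
for every real Brownian motion `B` with continuous paths on any probability space and every
`κ ∉ {0, 8}`, almost surely the chordal Loewner chain driven by `√κ B` is generated by a curve
(`Loewner.IsGeneratedByCurve`).

The tree proves Thm. 3.6 on the canonical Wiener space (`RohdeSchramm2005_thm36_of_cor35`); but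
all its stochastic inputs are stated for an arbitrary Brownian motion — the derivative estimate
Cor. 3.5 is the theorem `RohdeSchramm2005_cor35_holds P` for every measure `P`, its grid form
`RohdeSchramm2005_cor35.ae_exists_grid` and the modulus of continuity
`IsBrownianReal.ae_forall_exists_abs_sub_le_sqrt` take any `IsBrownianReal B P` — and the rest is
deterministic (`Loewner.continuousOn_extendFrom_tipApproach`, scale invariance
`Loewner.continuous_extendFrom_tipApproach_of_scales` with the rescaled Brownian motions
`2^{-n} B(4ⁿ ·)`, and the trace criterion Thm. 4.1 `RohdeSchramm2005_thm41_holds`). We run the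
same proof verbatim for a general `B` (`ae_exists_continuous_tipExtension`,
`ae_isGeneratedByCurve_of_isBrownianReal`). The general form is what the radial/whole-plane
theory consumes: the Brownian motion driving the auxiliary chordal chain of the Schramm–Wilson
coordinate change lives on an enlarged product space, not on the canonical one, and the trace
event is not known to be measurable, so it cannot be transported in law.

## References

* S. Rohde, O. Schramm, *Basic properties of SLE*, Ann. of Math. 161 (2005), Thm. 3.6, Thm. 4.1,
  Thm. 5.1. [RohdeSchramm2005]
* G. F. Lawler, *Conformally Invariant Processes in the Plane*, AMS (2005), §7.4. [Lawler2005]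
-/

noncomputable section

open Set Filter Topology Metric Complex MeasureTheory ProbabilityTheory
open UpperHalfPlane (upperHalfPlaneSet)
open scoped NNReal

namespace Literature.Probability.RandomPlanarGeometry

variable {Ω : Type*} {mΩ : MeasurableSpace Ω} {P : Measure Ω} {B : ℝ≥0 → Ω → ℝ}

/-- **Rohde–Schramm (2005), Thm. 3.6, for every Brownian motion**: for `κ ∉ {0, 8}` and a real
Brownian motion `B` with continuous paths on any probability space, almost surely
`H(y, t) = f̂ₜ(iy) = gₜ⁻¹(√κ Bₜ + iy)` extends continuously to `[0, ∞) × [0, ∞)`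
(the proof of `RohdeSchramm2005_thm36_of_cor35`, run for `B`). [cite: RohdeSchramm2005, Thm 3.6] -/
theorem ae_exists_continuous_tipExtension [IsProbabilityMeasure P] (hB : IsBrownianReal B P)
    (hBc : ∀ ω, Continuous (B · ω)) {κ : ℝ≥0} (hκ : κ ≠ 0) (h8 : κ ≠ 8) :
    ∀ᵐ ω ∂P, ∃ H : ℝ≥0 × ℝ≥0 → ℂ, Continuous H ∧ ∀ (y t : ℝ≥0), y ≠ 0 →
      H (y, t) = Function.invFunOn (Loewner.map (fun s ↦ Real.sqrt κ * B s ω) t)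
        (Loewner.domain (fun s ↦ Real.sqrt κ * B s ω) t) (((Real.sqrt κ * B t ω : ℝ) : ℂ) + I * (y : ℝ)) := by
  have h := RohdeSchramm2005_cor35_holds P
  have hκpos : (0 : ℝ) < κ := by exact_mod_cast pos_iff_ne_zero.2 hκ
  set σ : ℝ := RohdeSchramm.sigma0 κ / 2 with hσ
  have hσpos : 0 < RohdeSchramm.sigma0 κ := RohdeSchramm.sigma0_pos hκpos (by exact_mod_cast h8)
  have hσ0 : 0 < σ := by positivity
  have hσ1 : σ < RohdeSchramm.sigma0 κ := by rw [hσ]; linarith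
  -- the rescaled Brownian motions `Bₙ(t) = 2^{-n} B(4ⁿ t)`
  set Bs : ℕ → ℝ≥0 → Ω → ℝ := fun n t ω ↦
    (√((((2 : ℝ≥0) ^ n) ^ 2 : ℝ≥0) : ℝ))⁻¹ * B (((2 : ℝ≥0) ^ n) ^ 2 * t) ω with hBs
  have hBn : ∀ n, IsBrownianReal (Bs n) P := fun n ↦ hB.smul (pow_ne_zero 2 (pow_ne_zero n two_ne_zero))
  have hBnc : ∀ n ω, Continuous fun t ↦ Bs n t ω := fun n ω ↦
    continuous_const.mul ((hBc ω).comp (continuous_const.mul continuous_id))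
  have hsq : ∀ n : ℕ, √((((2 : ℝ≥0) ^ n) ^ 2 : ℝ≥0) : ℝ) = ((2 ^ n : ℝ≥0) : ℝ) := fun n ↦ by
    push_cast
    exact Real.sqrt_sq (by positivity)
  -- almost surely: grid bounds and modulus at every scale
  have hgrid : ∀ n, ∀ᵐ ω ∂P, ∃ c : ℝ, ∀ j k : ℕ, k < 4 ^ j →
      ‖deriv (Loewner.fHat (fun s ↦ Real.sqrt κ * Bs n s ω) ((k : ℝ≥0) / 4 ^ j))
        (I * ((2 : ℝ) ^ (-(j : ℝ)) : ℝ))‖ ≤ c * (2 : ℝ) ^ ((1 - σ) * j) :=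
    fun n ↦ h.ae_exists_grid hκ h8 hσ0 hσ1 (hBn n) (hBnc n)
  have hmod : ∀ n, ∀ᵐ ω ∂P, ∃ c : ℝ, ∀ j : ℕ, 1 ≤ j → ∀ s t : ℝ≥0,
      s ≤ (2 : ℕ) → t ≤ (2 : ℕ) → dist s t ≤ (4 ^ j)⁻¹ →
      |Bs n s ω - Bs n t ω| ≤ c * Real.sqrt j / 2 ^ j := fun n ↦ by
    filter_upwards [(hBn n).ae_forall_exists_abs_sub_le_sqrt] with ω hω using hω 2
  rw [← ae_all_iff] at hgrid hmod
  filter_upwards [hgrid, hmod] with ω hg hm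
  -- deterministic part, for the fixed path `ω`
  set W : ℝ≥0 → ℝ := fun s ↦ Real.sqrt κ * B s ω with hWdef
  have hW : Continuous W := continuous_const.mul (hBc ω)
  set V : ℕ → ℝ≥0 → ℝ := fun n s ↦ Real.sqrt κ * Bs n s ω with hV
  have hVc : ∀ n, Continuous (V n) := fun n ↦ continuous_const.mul (hBnc n ω)
  have hWV : ∀ n (s : ℝ≥0), W s = ((2 ^ n : ℝ≥0) : ℝ) * V n (s / (2 ^ n) ^ 2) := by
    intro n s
    have hc : ((2 : ℝ≥0) ^ n) ^ 2 ≠ 0 := pow_ne_zero 2 (pow_ne_zero n two_ne_zero)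
    rw [hWdef, hV, hBs]
    simp only
    rw [hsq n, mul_div_cancel₀ _ hc]
    have h2 : ((2 ^ n : ℝ≥0) : ℝ) ≠ 0 := by positivity
    field_simp
  obtain ⟨hc, heq⟩ := Loewner.continuous_extendFrom_tipApproach_of_scales hW V hVc hWV fun n ↦ by
    obtain ⟨c₁, hc₁⟩ := hg n
    obtain ⟨c₂, hc₂⟩ := hm n
    refine Loewner.continuousOn_extendFrom_tipApproach (hVc n) hσ0 hc₁ (c₂ := Real.sqrt κ * c₂) ?_
    intro j hj s t hs ht hd
    have h1 := hc₂ j hj s t (by simpa using hs) (by simpa using ht) hd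
    rw [hV]
    simp only
    rw [← mul_sub, abs_mul, abs_of_nonneg (Real.sqrt_nonneg _), mul_assoc, mul_div_assoc]
    exact mul_le_mul_of_nonneg_left h1 (Real.sqrt_nonneg _)
  exact ⟨_, hc, fun y t hy ↦ by rw [heq (y, t) hy]; rfl⟩

/-- **Rohde–Schramm (2005), Thm. 5.1 (`κ ≠ 8`), for every Brownian motion**: for `κ ∉ {0, 8}`
and a real Brownian motion `B` with continuous paths on any probability space, almost surely the
chordal Loewner chain driven by `√κ B` is generated by a curve (Thm. 3.6 for `B`,
`ae_exists_continuous_tipExtension`, and the deterministic criterion Thm. 4.1,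
`RohdeSchramm2005_thm41_holds`). [cite: RohdeSchramm2005, Thm 5.1] -/
theorem ae_isGeneratedByCurve_of_isBrownianReal [IsProbabilityMeasure P] (hB : IsBrownianReal B P)
    (hBc : ∀ ω, Continuous (B · ω)) {κ : ℝ≥0} (hκ : κ ≠ 0) (h8 : κ ≠ 8) :
    ∀ᵐ ω ∂P, ∃ γ : ℝ≥0 → ℂ, Loewner.IsGeneratedByCurve (fun s ↦ Real.sqrt κ * B s ω) γ := by
  filter_upwards [ae_exists_continuous_tipExtension hB hBc hκ h8] with ω ⟨H, hHc, hH⟩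
  set ξ : ℝ≥0 → ℝ := fun s ↦ Real.sqrt κ * B s ω with hξ
  have hξc : Continuous ξ := continuous_const.mul (hBc ω)
  set β : ℝ≥0 → ℂ := fun t ↦ H (0, t) with hβ
  refine ⟨β, Loewner.isGeneratedByCurve_of_thm41 RohdeSchramm2005_thm41_holds hξc
    (hHc.comp (Continuous.prodMk continuous_const continuous_id)) fun t ↦ ?_⟩
  have hpath : Tendsto (fun y : ℝ ↦ ((y.toNNReal, t) : ℝ≥0 × ℝ≥0)) (𝓝[>] 0) (𝓝 (0, t)) := by
    have : Tendsto (fun y : ℝ ↦ ((y.toNNReal, t) : ℝ≥0 × ℝ≥0)) (𝓝 0) (𝓝 ((0 : ℝ).toNNReal, t)) :=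
      ((continuous_real_toNNReal.prodMk continuous_const).tendsto 0)
    simpa using this.mono_left nhdsWithin_le_nhds
  refine ((hHc.continuousAt.tendsto).comp hpath).congr' ?_
  filter_upwards [self_mem_nhdsWithin] with y hy
  have hy' : (y.toNNReal : ℝ≥0) ≠ 0 := by simpa using hy
  rw [Function.comp_apply, hH _ _ hy', Real.coe_toNNReal _ (le_of_lt hy)]

end Literature.Probability.RandomPlanarGeometry
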